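import Mathlib
import HarnessLib
import Summits.Ventures.LatticeQCDFlow.Exactness.U1GaugeCovariance
import Summits.Ventures.LatticeQCDFlow.Exactness.SU2MaskedKickJacobianInvariance
import Summits.Ventures.LatticeQCDFlow.Exactness.U1WilsonFlowLOSubstep

/-!
# Member level on the `U(1)` rung: the engine's whole `U(1)` LO Wilson-flow member is gauge equivariant with a gauge-invariant running log-det; its pulled-back action is a class function

HONEST FRAMING: exact (Metropolis-corrected) sampling algorithms for lattice gauge theory;
figures of merit are autocorrelation/cost numbers at stated couplings and volumes; no
continuum-physics claim.

Venture `LatticeQCDFlow` (cell pub-lqcd), topic `Exactness`; FANOUT row 14 (`eng-flowhmc`, engine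
`latflow.fthmc`, family B; member `maps.u1_wilson_flow_lo`).  NEW WORK of the cell; nothing is cited
as a fact; no number.  The `U(1)` companion of `SU2MemberGaugeCovariance.lean`: layer facts from
`U1GaugeCovariance.lean` (`isGaugeEquivariant_u1WilsonFlowLOSubstep`,
`isGaugeInvariant_u1WilsonFlowLOJacobian`), transfer and composition from
`SU2MaskedKickJacobianInvariance.lean` (`gauge_of_layers_map_eq`, `isGaugeEquivariant_foldr_trans`,
`isGaugeInvariant_foldr_logDet`, `isGaugeInvariant_ftAction` — all stated for any group).

* **`u1WilsonFlowLO_member_gauge`** — for ANY list `layers` packaged as in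
  `exists_layers_u1WilsonFlowLO` (map equation VERBATIM as hypothesis; any schedule, any
  colouring, any `ε`): the composite member is `IsGaugeEquivariant` and its running density is
  `IsGaugeInvariant`;
* **`u1WilsonFlowLO_member_ftAction`** — hence `S(F V) − log J(V)` is gauge invariant for every
  gauge-invariant action `S`.

NOT CLAIMED: the learned `U(1)` members; momenta / forces; any number.
-/

noncomputable section

namespace Summit.Ventures.LatticeQCDFlow.Exactness

open Literature.MathematicalPhysics.QuantumFieldTheory

variable {d L : ℕ} {X : Type*} [DecidableEq X] (χ : Site d L → X) [NeZero L]

/-- **The `U(1)` LO Wilson-flow member is gauge equivariant with a gauge-invariant running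
log-det** — for ANY `layers` packaged as in `exists_layers_u1WilsonFlowLO`. -/
theorem u1WilsonFlowLO_member_gauge (ε : ℝ) (sched : List (Fin d × X)) (layers : List ((GaugeConfig d L Circle ≃ᵐ GaugeConfig d L Circle) × (GaugeConfig d L Circle → ℝ)))
    (hmap :
      layers.map (fun Ly => ((Ly.1 : GaugeConfig d L Circle → GaugeConfig d L Circle), Ly.2)) = sched.map (fun s =>
        ((fun (V : GaugeConfig d L Circle) (e : Edge d L) => if e.2 = s.1 ∧ χ e.1 = s.2 then
          V e * Circle.exp (ε * ∑ ν ∈ Finset.univ.erase e.2,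
            (((plaquetteHolonomy V (e.1 - Pi.single ν 1) e.2 ν : Circle) : ℂ).im -
              ((plaquetteHolonomy V e.1 e.2 ν : Circle) : ℂ).im)) else V e),
         fun V : GaugeConfig d L Circle => ∏ a : {e : Edge d L // e.2 = s.1 ∧ χ e.1 = s.2},
          (1 - ε * ∑ ν ∈ Finset.univ.erase a.1.2,
            (((plaquetteHolonomy V a.1.1 a.1.2 ν : Circle) : ℂ).re +
              ((plaquetteHolonomy V (a.1.1 - Pi.single ν 1) a.1.2 ν : Circle) : ℂ).re))))) :
    IsGaugeEquivariant (⇑(layers.foldr (fun Ly (F : GaugeConfig d L Circle ≃ᵐ GaugeConfig d L Circle) => Ly.1.trans F) (MeasurableEquiv.refl (GaugeConfig d L Circle)))) ∧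
    IsGaugeInvariant (layers.foldr (fun Ly K => fun v => Ly.2 v * K (Ly.1 v)) (fun _ => (1 : ℝ))) := by
  have key := gauge_of_layers_map_eq layers sched
    (fun s => (fun (V : GaugeConfig d L Circle) (e : Edge d L) => if e.2 = s.1 ∧ χ e.1 = s.2 then
          V e * Circle.exp (ε * ∑ ν ∈ Finset.univ.erase e.2,
            (((plaquetteHolonomy V (e.1 - Pi.single ν 1) e.2 ν : Circle) : ℂ).im -
              ((plaquetteHolonomy V e.1 e.2 ν : Circle) : ℂ).im)) else V e))
    (fun s => fun V : GaugeConfig d L Circle => ∏ a : {e : Edge d L // e.2 = s.1 ∧ χ e.1 = s.2},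
          (1 - ε * ∑ ν ∈ Finset.univ.erase a.1.2,
            (((plaquetteHolonomy V a.1.1 a.1.2 ν : Circle) : ℂ).re +
              ((plaquetteHolonomy V (a.1.1 - Pi.single ν 1) a.1.2 ν : Circle) : ℂ).re)))
    hmap
    (fun s _ => isGaugeEquivariant_u1WilsonFlowLOSubstep χ s.1 s.2 ε)
    (fun s _ => isGaugeInvariant_u1WilsonFlowLOJacobian χ s.1 s.2 ε)
  exact ⟨isGaugeEquivariant_foldr_trans layers key.1, isGaugeInvariant_foldr_logDet layers key.1 key.2⟩

/-- **Hence the pulled-back action of the `U(1)` LO member is a class function** for every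
gauge-invariant action `S`. -/
theorem u1WilsonFlowLO_member_ftAction (ε : ℝ) (sched : List (Fin d × X)) (layers : List ((GaugeConfig d L Circle ≃ᵐ GaugeConfig d L Circle) × (GaugeConfig d L Circle → ℝ)))
    (hmap :
      layers.map (fun Ly => ((Ly.1 : GaugeConfig d L Circle → GaugeConfig d L Circle), Ly.2)) = sched.map (fun s =>
        ((fun (V : GaugeConfig d L Circle) (e : Edge d L) => if e.2 = s.1 ∧ χ e.1 = s.2 then
          V e * Circle.exp (ε * ∑ ν ∈ Finset.univ.erase e.2,
            (((plaquetteHolonomy V (e.1 - Pi.single ν 1) e.2 ν : Circle) : ℂ).im -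
              ((plaquetteHolonomy V e.1 e.2 ν : Circle) : ℂ).im)) else V e),
         fun V : GaugeConfig d L Circle => ∏ a : {e : Edge d L // e.2 = s.1 ∧ χ e.1 = s.2},
          (1 - ε * ∑ ν ∈ Finset.univ.erase a.1.2,
            (((plaquetteHolonomy V a.1.1 a.1.2 ν : Circle) : ℂ).re +
              ((plaquetteHolonomy V (a.1.1 - Pi.single ν 1) a.1.2 ν : Circle) : ℂ).re)))))
    {S : GaugeConfig d L Circle → ℝ} (hS : IsGaugeInvariant S) :
    IsGaugeInvariant (fun V : GaugeConfig d L Circle => S ((layers.foldr (fun Ly (F : GaugeConfig d L Circle ≃ᵐ GaugeConfig d L Circle) => Ly.1.trans F) (MeasurableEquiv.refl (GaugeConfig d L Circle))) V) - Real.log ((layers.foldr (fun Ly K => fun v => Ly.2 v * K (Ly.1 v)) (fun _ => (1 : ℝ))) V)) := by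
  obtain ⟨hF, hJ⟩ := u1WilsonFlowLO_member_gauge χ ε sched layers hmap
  exact isGaugeInvariant_ftAction hS hF hJ

end Summit.Ventures.LatticeQCDFlow.Exactness
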